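import Mathlib.Analysis.Calculus.BumpFunction.InnerProduct
import Literature.Geometry.Lorentzian.GaussianBeamFunction
import Literature.Analysis.Asymptotics.GaussianLeafIntegrals
import HarnessLib

/-!
# The error terms of the explicit Gaussian beam: flatness along the curve and flat bounds
(trunk G08 = T-LORENTZ, geometric optics; namespace `Literature.Geometry.Lorentzian.GaussianBeam`)

Sbierski, Anal. PDE 8 (2015), §3, proof of the second lemma (= arXiv:1311.2477v2 §2.2, proof
of Lemma 5): with `φ` eikonal to second order and `a` transported to zeroth order along `γ`,
the three terms of `□u_λ = e^{iλφ}(−λ² (dφ·dφ) a + iλ(2 grad φ(a) + □φ a) + □a)` are, after the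
first lemma of §3, `O(λ² |x̲|³)`, `O(λ |x̲|)` and `O(1)` times `e^{-λ Im φ}`, `Im φ ≥ c |x̲|²` —
the *flat bounds* behind `‖□u_λ‖_{L²(R_{[0,T]})} ≤ C`. This file derives them for the explicit
beam `GaussianBeamFunction.BeamAmp.beam` from the vanishing orders proved in
`GaussianBeamDefect.lean` (orders `0, 1, 2` of the defect along spatial lines, polarised by
`iteratedFDeriv_eq_zero_of_lines`) and `GaussianBeamAmplitude.lean` (transport at the curve), via
the uniform flat bound `exists_norm_le_norm_sub_pow` of `GaussianLeafIntegrals.lean`: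

* bookkeeping: `E4.ofTimeSpace` as a smooth map / homeomorphism `ℝ × E3 → E4`
  (`contDiff_ofTimeSpace_uncurry`, `timeSpaceHomeomorph`, `hasCompactSupport_comp_ofTimeSpace`,
  `ofTimeSpace_add_smul`); a smooth global stand-in `BeamAmp.ce` for the centre `c`, equal to
  `c` on the hull `BeamAmp.timeHull ⊆ J` of the times met by `supp a` and `[0, T]`
  (`exists_contDiff_eqOn_Icc`, a bump-function extension);
* `BeamAmp.eikErr = a · s(dφ, dφ)` read on `ℝ × E3`: `C^∞`, compactly supported, **vanishing to
  order `2` along the centre** (`iteratedFDeriv_eikErr_eq_zero`), hence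
  `‖a(x) s(dφ,dφ)(x)‖ ≤ D₁ ‖x⃗ − c(x⁰)‖³` (`exists_eik_bound`);
* `BeamAmp.trErr = 2 s(dφ, da) + a □φ`: `C^∞`, compactly supported, vanishing on the curve over
  `(−η, T + η)`, hence `‖…‖ ≤ D₂ ‖x⃗ − c(x⁰)‖` for `x⁰ ∈ [0, T]` (`exists_tr_bound`);
* `exists_box_amp_bound` — `‖□a‖ ≤ D₃`;
* `exists_pos_le_im_phase_tsupport` — `Im φ(x) ≥ c₀ ‖x⃗ − c(x⁰)‖²` on `tsupport a`.

## References

* J. Sbierski, *Characterisation of the energy of Gaussian beams on Lorentzian manifolds: with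
  applications to black hole spacetimes*, Anal. PDE 8 (2015) 1379–1420, §3 (second lemma and its
  proof); arXiv:1311.2477v2 §2.2, Lemma 5 (key `Sbierski2015`).
-/

noncomputable section

open Set Filter Complex Metric
open scoped ContDiff Topology

namespace Literature.Geometry.Lorentzian

namespace GaussianBeam

open KerrSchild

/-! ### Time–space bookkeeping -/

/-- `(t, y + s u) = (t, y) + s (0, u)`. [folklore] -/
theorem ofTimeSpace_add_smul (t : ℝ) (y u : E3) (s : ℝ) :
    E4.ofTimeSpace t (y + s • u) = E4.ofTimeSpace t y + s • E4.ofTimeSpace 0 u := by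
  simp only [E4.ofTimeSpace_eq_smul_add', map_add, map_smul, zero_smul, zero_add]
  abel

/-- `(t, y) ↦ (t, y) ∈ E4` is `C^∞`. [folklore] -/
theorem contDiff_ofTimeSpace_uncurry {n : ℕ∞ω} :
    ContDiff ℝ n fun q : ℝ × E3 ↦ E4.ofTimeSpace q.1 q.2 := by
  have : (fun q : ℝ × E3 ↦ E4.ofTimeSpace q.1 q.2) =
      fun q ↦ q.1 • E4.basisVector 0 + E4.spaceEmbed q.2 :=
    funext fun q ↦ E4.ofTimeSpace_eq_smul_add' q.1 q.2
  rw [this]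
  fun_prop

/-- The time–space splitting as a homeomorphism `ℝ × E3 ≃ₜ E4`. [folklore] -/
def timeSpaceHomeomorph : ℝ × E3 ≃ₜ E4 where
  toFun q := E4.ofTimeSpace q.1 q.2
  invFun x := (x 0, E4.spatial x)
  left_inv q := by simp
  right_inv x := E4.ofTimeSpace_time_spatial x
  continuous_toFun := (contDiff_ofTimeSpace_uncurry (n := 0)).continuous
  continuous_invFun := ((E4.dx 0).continuous).prodMk E4.spatial.continuous

/-- A compactly supported function on `E4` read on `ℝ × E3` is compactly supported. [folklore] -/
theorem hasCompactSupport_comp_ofTimeSpace {F : Type*} [Zero F] [TopologicalSpace F]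
    {f : E4 → F} (hf : HasCompactSupport f) :
    HasCompactSupport fun q : ℝ × E3 ↦ f (E4.ofTimeSpace q.1 q.2) :=
  hf.comp_homeomorph timeSpaceHomeomorph

/-- The homeomorphism is the time–space assembly. [folklore] -/
@[simp] theorem timeSpaceHomeomorph_apply (q : ℝ × E3) :
    timeSpaceHomeomorph q = E4.ofTimeSpace q.1 q.2 := rfl

/-! ### Smooth stand-ins supported inside an open set -/

/-- A smooth scalar function supported inside an open `U` times a vector function smooth on `U`
is smooth. [folklore] -/
theorem contDiff_smul_of_tsupport {F : Type*} [NormedAddCommGroup F] [NormedSpace ℝ F]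
    {W : Type*} [NormedAddCommGroup W] [NormedSpace ℝ W] {n : ℕ∞ω}
    {ρ : W → ℝ} {g : W → F} {U : Set W} (hU : IsOpen U) (hρ : ContDiff ℝ n ρ) (hρs : tsupport ρ ⊆ U)
    (hg : ContDiffOn ℝ n g U) : ContDiff ℝ n fun x ↦ ρ x • g x := by
  rw [contDiff_iff_contDiffAt]
  intro x
  by_cases hx : x ∈ U
  · exact hρ.contDiffAt.smul (hg.contDiffAt (hU.mem_nhds hx))
  · have hxf : x ∉ tsupport ρ := fun h ↦ hx (hρs h)
    have hzero : (fun y ↦ ρ y • g y) =ᶠ[𝓝 x] fun _ ↦ 0 := by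
      filter_upwards [(isClosed_tsupport ρ).isOpen_compl.mem_nhds hxf] with y hy
      simp [image_eq_zero_of_notMem_tsupport hy]
    exact contDiffAt_const.congr_of_eventuallyEq hzero

/-- **Smooth global stand-in for a function smooth on an open interval, on a compact sub-interval**:
for `J` open and order-connected, `[a, b] ⊆ J` and `c` of class `C^∞` on `J` (componentwise),
there is a `C^∞` function `ce : ℝ → E3` equal to `c` on `[a, b]` (cut `c` off with a bump equal
to one on `[a, b]` and supported inside `J`). [folklore] -/
theorem exists_contDiff_eqOn_Icc {c : ℝ → E3} {J : Set ℝ} (hJ : IsOpen J) (hJc : J.OrdConnected)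
    (hc : ∀ i, ContDiffOn ℝ ∞ (fun t ↦ c t i) J) {a b : ℝ} (hab : a ≤ b) (ha : a ∈ J) (hb : b ∈ J) :
    ∃ ce : ℝ → E3, ContDiff ℝ ∞ ce ∧ EqOn ce c (Icc a b) := by
  -- room inside `J` around the endpoints
  obtain ⟨ε₁, hε₁, hε₁J⟩ := Metric.isOpen_iff.1 hJ a ha
  obtain ⟨ε₂, hε₂, hε₂J⟩ := Metric.isOpen_iff.1 hJ b hb
  set ε : ℝ := min ε₁ ε₂ / 3 with hε
  have hεpos : 0 < ε := by positivity
  have hε1 : 2 * ε < ε₁ := by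
    have : min ε₁ ε₂ ≤ ε₁ := min_le_left _ _
    rw [hε]; linarith
  have hε2 : 2 * ε < ε₂ := by
    have : min ε₁ ε₂ ≤ ε₂ := min_le_right _ _
    rw [hε]; linarith
  have haJ : a - 2 * ε ∈ J := hε₁J (by rw [Metric.mem_ball, Real.dist_eq, abs_of_nonpos (by linarith)]; linarith)
  have hbJ : b + 2 * ε ∈ J := hε₂J (by rw [Metric.mem_ball, Real.dist_eq, abs_of_nonneg (by linarith)]; linarith)
  have hIJ : Icc (a - 2 * ε) (b + 2 * ε) ⊆ J := hJc.out haJ hbJ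
  -- the bump
  let ρ : ContDiffBump ((a + b) / 2) :=
    { rIn := (b - a) / 2 + ε
      rOut := (b - a) / 2 + 2 * ε
      rIn_pos := by linarith
      rIn_lt_rOut := by linarith }
  have hrIn : ρ.rIn = (b - a) / 2 + ε := rfl
  have hrOut : ρ.rOut = (b - a) / 2 + 2 * ε := rfl
  have hρs : tsupport (ρ : ℝ → ℝ) ⊆ J := by
    rw [ρ.tsupport_eq]
    intro t ht
    rw [Metric.mem_closedBall, Real.dist_eq, abs_le, hrOut] at ht
    exact hIJ ⟨by linarith [ht.1], by linarith [ht.2]⟩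
  have hcJ : ContDiffOn ℝ ∞ c J := by
    rw [contDiffOn_piLp]; exact hc
  refine ⟨fun t ↦ (ρ : ℝ → ℝ) t • c t, contDiff_smul_of_tsupport hJ ρ.contDiff hρs hcJ, fun t ht ↦ ?_⟩
  have h1 : (ρ : ℝ → ℝ) t = 1 := by
    apply ρ.one_of_mem_closedBall
    rw [Metric.mem_closedBall, Real.dist_eq, abs_le, hrIn]
    exact ⟨by linarith [ht.1, ht.2], by linarith [ht.1, ht.2]⟩
  simp [h1]

/-! ### The hull of the times met by the beam, and the smooth centre -/

namespace BeamAmp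

variable {G : E4 → Fin 4 → Fin 4 → ℝ} {V : Set E4} {J : Set ℝ} {D : BeamData G V J} {T : ℝ}
  (A : BeamAmp D T)

/-- The times met by `supp a`, together with `[0, T]`. [folklore] -/
def timeSet : Set ℝ := (fun x : E4 ↦ x 0) '' tsupport A.amp ∪ Icc 0 T

/-- `timeSet` is compact. [folklore] -/
theorem isCompact_timeSet : IsCompact A.timeSet :=
  (A.compact.image (E4.dx 0).continuous).union isCompact_Icc

/-- `timeSet ⊆ J`. [folklore] -/
theorem timeSet_subset : A.timeSet ⊆ J := by
  rintro t (⟨x, hx, rfl⟩ | ht)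
  · exact A.tsupp_slab hx
  · exact A.Icc_subset ht

/-- `0 ∈ timeSet`. [folklore] -/
theorem zero_mem_timeSet : (0 : ℝ) ∈ A.timeSet := Or.inr ⟨le_rfl, A.hT0⟩

/-- **The hull of the times met by the beam**, a compact interval `[t₋, t₊] ⊆ J` containing
`[0, T]` and the time coordinates of `supp a`. [folklore] -/
def timeHull : Set ℝ := Icc (sInf A.timeSet) (sSup A.timeSet)

/-- The lower end lies in `J`. [folklore] -/
theorem sInf_mem : sInf A.timeSet ∈ J :=
  A.timeSet_subset (A.isCompact_timeSet.sInf_mem ⟨0, A.zero_mem_timeSet⟩)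

/-- The upper end lies in `J`. [folklore] -/
theorem sSup_mem : sSup A.timeSet ∈ J :=
  A.timeSet_subset (A.isCompact_timeSet.sSup_mem ⟨0, A.zero_mem_timeSet⟩)

/-- `t₋ ≤ t₊`. [folklore] -/
theorem sInf_le_sSup : sInf A.timeSet ≤ sSup A.timeSet :=
  (csInf_le A.isCompact_timeSet.bddBelow A.zero_mem_timeSet).trans
    (le_csSup A.isCompact_timeSet.bddAbove A.zero_mem_timeSet)

/-- `timeHull ⊆ J`. [folklore] -/
theorem timeHull_subset : A.timeHull ⊆ J := D.hJc.out A.sInf_mem A.sSup_mem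

/-- Points of `timeSet` lie in the hull. [folklore] -/
theorem mem_timeHull_of_mem_timeSet {t : ℝ} (ht : t ∈ A.timeSet) : t ∈ A.timeHull :=
  ⟨csInf_le A.isCompact_timeSet.bddBelow ht, le_csSup A.isCompact_timeSet.bddAbove ht⟩

/-- The time of a point of `supp a` lies in the hull. [folklore] -/
theorem mem_timeHull_of_mem_tsupport {x : E4} (hx : x ∈ tsupport A.amp) : x 0 ∈ A.timeHull :=
  A.mem_timeHull_of_mem_timeSet (Or.inl ⟨x, hx, rfl⟩)

/-- `[0, T] ⊆ timeHull`. [folklore] -/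
theorem Icc_subset_timeHull : Icc (0 : ℝ) T ⊆ A.timeHull := fun _ ht ↦
  A.mem_timeHull_of_mem_timeSet (Or.inr ht)

/-- The amplitude at a curve point of the core range is `A₀ ≠ 0`. [folklore] -/
theorem amp_X {t : ℝ} (ht : t ∈ Ioo (-A.η) (T + A.η)) : A.amp (D.X t) = D.A₀ t := by
  have h := (A.core t ht).self_of_nhds
  simpa [BeamData.X] using h

/-- `(−η, T + η) ⊆ timeHull` (there `a(X(t)) = A₀(t) ≠ 0`). [folklore] -/
theorem Ioo_subset_timeHull : Ioo (-A.η) (T + A.η) ⊆ A.timeHull := by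
  intro t ht
  have hX : D.X t ∈ tsupport A.amp := subset_tsupport _ (by
    rw [Function.mem_support, A.amp_X ht]; exact D.A₀_ne_zero t)
  simpa [BeamData.X] using A.mem_timeHull_of_mem_tsupport hX

/-- If the slice at time `t` meets `supp a` then `t ∈ timeHull`; contrapositive. [folklore] -/
theorem amp_ofTimeSpace_eq_zero {t : ℝ} (ht : t ∉ A.timeHull) (y : E3) :
    A.amp (E4.ofTimeSpace t y) = 0 := by
  by_contra h
  exact ht (by simpa using A.mem_timeHull_of_mem_tsupport (subset_tsupport _ h))

/-- **The smooth centre**: a `C^∞` map `ℝ → E3` equal to `c` on the hull. [folklore] -/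
def ce : ℝ → E3 :=
  Classical.choose (exists_contDiff_eqOn_Icc D.hJ D.hJc D.hc A.sInf_le_sSup A.sInf_mem A.sSup_mem)

/-- The smooth centre is `C^∞`. [folklore] -/
theorem contDiff_ce : ContDiff ℝ ∞ A.ce :=
  (Classical.choose_spec
    (exists_contDiff_eqOn_Icc D.hJ D.hJc D.hc A.sInf_le_sSup A.sInf_mem A.sSup_mem)).1

/-- The smooth centre is `c` on the hull. [folklore] -/
theorem ce_eq {t : ℝ} (ht : t ∈ A.timeHull) : A.ce t = D.c t :=
  (Classical.choose_spec
    (exists_contDiff_eqOn_Icc D.hJ D.hJc D.hc A.sInf_le_sSup A.sInf_mem A.sSup_mem)).2 ht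

/-! ### Smoothness of the ingredients on `V ∩ {x⁰ ∈ J}` -/

/-- The defect is `C^∞` on `V ∩ {x⁰ ∈ J}`. [folklore] -/
theorem _root_.Literature.Geometry.Lorentzian.GaussianBeam.BeamData.contDiffOn_defect
    (D : BeamData G V J) :
    ContDiffOn ℝ ∞ (defect G D.P D.M D.c) (V ∩ {x : E4 | x 0 ∈ J}) := by
  unfold defect
  refine ContDiffOn.sum fun μ _ ↦ ContDiffOn.sum fun ν _ ↦ ?_
  have hd : ∀ μ, ContDiffOn ℝ ∞ (dphase D.P D.M D.c μ) (V ∩ {x : E4 | x 0 ∈ J}) := fun μ ↦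
    (contDiffOn_dphase D.hJ D.hP D.hM D.hc μ).mono inter_subset_right
  exact ((Complex.ofRealCLM.contDiff.comp_contDiffOn ((D.hG μ ν).mono inter_subset_left)).mul
    (hd μ)).mul (hd ν)

/-- `a · s(dφ, dφ)` is `C^∞` on the chart. [folklore] -/
theorem contDiff_amp_mul_defect : ContDiff ℝ ∞ fun x ↦ A.amp x * defect G D.P D.M D.c x :=
  contDiff_mul_of_tsupport D.isOpen_inter_slab A.smooth A.tsupp D.contDiffOn_defect

/-! ### The eikonal error `a · s(dφ, dφ)` vanishes to order two along the centre -/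

/-- **The eikonal error** `a(x) · s(dφ, dφ)(x)` (`= a · defect`, `symbolC_phase`) read on
`ℝ × E3`. [cite: Sbierski2015, §3 (second lemma, proof)] -/
def eikErr (q : ℝ × E3) : ℂ :=
  A.amp (E4.ofTimeSpace q.1 q.2) * defect G D.P D.M D.c (E4.ofTimeSpace q.1 q.2)

/-- The eikonal error is `C^∞`. [folklore] -/
theorem contDiff_eikErr : ContDiff ℝ ∞ A.eikErr :=
  A.contDiff_amp_mul_defect.comp contDiff_ofTimeSpace_uncurry

/-- The eikonal error has compact support. [folklore] -/
theorem hasCompactSupport_eikErr : HasCompactSupport A.eikErr :=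
  hasCompactSupport_comp_ofTimeSpace (f := fun x ↦ A.amp x * defect G D.P D.M D.c x)
    A.compact.mul_right

/-- The slice of the eikonal error at a time outside the hull vanishes. [folklore] -/
theorem eikErr_of_not_mem {t : ℝ} (ht : t ∉ A.timeHull) (y : E3) : A.eikErr (t, y) = 0 := by
  simp [eikErr, A.amp_ofTimeSpace_eq_zero ht y]

/-- **The eikonal error vanishes to order two along the centre**: for every `t`, the
`y`-derivatives of order `≤ 2` of `y ↦ a(t,y) s(dφ,dφ)(t,y)` vanish at `y = ce(t)` (orders
`0, 1, 2` of the defect along spatial lines — null condition, bicharacteristic equation, Riccati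
equation — times the amplitude, polarised). [cite: Sbierski2015, §3 (3.9); arXiv v2 §2.2 (2.12)–(2.14)] -/
theorem iteratedFDeriv_eikErr_eq_zero (t : ℝ) {k : ℕ} (hk : k ≤ 2) :
    iteratedFDeriv ℝ k (fun y ↦ A.eikErr (t, y)) (A.ce t) = 0 := by
  by_cases ht : t ∈ A.timeHull
  · have htJ : t ∈ J := A.timeHull_subset ht
    rw [A.ce_eq ht]
    -- the slice is smooth
    have hF : ContDiff ℝ ∞ fun y ↦ A.eikErr (t, y) :=
      A.contDiff_eikErr.comp (contDiff_const.prodMk contDiff_id)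
    -- the line data of the defect
    have hXV : E4.ofTimeSpace t (D.c t) ∈ V := D.hXV t htJ
    have hline : ∀ u : E3, ∀ s : ℝ, E4.ofTimeSpace t (D.c t + s • u) =
        E4.ofTimeSpace t (D.c t) + s • E4.ofTimeSpace 0 u := fun u s ↦ ofTimeSpace_add_smul t _ u s
    have hw : ∀ u : E3, (E4.ofTimeSpace 0 u) 0 = 0 := fun u ↦ by simp
    refine iteratedFDeriv_eq_zero_of_lines hF ?_ (fun u ↦ ?_) (fun u ↦ ?_) k hk
    · -- order 0
      simp [eikErr, defect_curve G D.P D.M D.c t (D.hPX t htJ) (D.hnull t htJ)]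
    all_goals
      set w : E4 := E4.ofTimeSpace 0 u with hw_def
      have hfun : (fun s : ℝ ↦ A.eikErr (t, D.c t + s • u)) =
          (fun s ↦ defect G D.P D.M D.c (E4.ofTimeSpace t (D.c t) + s • w)) *
            fun s ↦ A.amp (E4.ofTimeSpace t (D.c t) + s • w) := by
        funext s
        simp only [eikErr, Pi.mul_apply, hline u s]
        ring
      -- the defect along the line
      have hnear : ∀ᶠ s in 𝓝 (0 : ℝ), E4.ofTimeSpace t (D.c t) + s • w ∈ V := by
        have hcont : Continuous fun s : ℝ ↦ E4.ofTimeSpace t (D.c t) + s • w := by fun_prop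
        exact hcont.continuousAt.preimage_mem_nhds (by simpa using D.hV.mem_nhds hXV)
      have hg : ∀ᶠ s in 𝓝 (0 : ℝ), HasDerivAt
          (fun s : ℝ ↦ defect G D.P D.M D.c (E4.ofTimeSpace t (D.c t) + s • w))
          (derivDefectLine G D.P D.M D.c t w s) s := by
        filter_upwards [hnear] with s hs using hasDerivAt_defect_line G D.P D.M D.c D.hV D.hG t (hw u) hs
      have hg0 : (fun s : ℝ ↦ defect G D.P D.M D.c (E4.ofTimeSpace t (D.c t) + s • w)) 0 = 0 := by
        simpa using defect_curve G D.P D.M D.c t (D.hPX t htJ) (D.hnull t htJ)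
      have hg'0 := derivDefectLine_zero G D.P D.M D.c t (hw u) D.hGsymm (D.hPX t htJ) (D.hsymm t htJ)
        (D.hMX t htJ) (D.hvel t htJ) (D.hbichar t htJ)
      have hg' := hasDerivAt_derivDefectLine G D.P D.M D.c D.hV D.hG t w hXV
      have hg'' := deriv2DefectLine_zero G D.P D.M D.c t (hw u) D.hGsymm (D.hPX t htJ) (D.hsymm t htJ)
        (D.hMX t htJ) (D.hvel t htJ) (D.hRic t htJ)
      -- the amplitude along the line
      have hac : ContDiff ℝ ∞ fun s : ℝ ↦ A.amp (E4.ofTimeSpace t (D.c t) + s • w) :=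
        A.smooth.comp (by fun_prop)
      have ha : ∀ᶠ s in 𝓝 (0 : ℝ), HasDerivAt (fun s : ℝ ↦ A.amp (E4.ofTimeSpace t (D.c t) + s • w))
          (deriv (fun s : ℝ ↦ A.amp (E4.ofTimeSpace t (D.c t) + s • w)) s) s :=
        Eventually.of_forall fun s ↦ (hac.differentiable (by simp) s).hasDerivAt
      have ha' : HasDerivAt (deriv fun s : ℝ ↦ A.amp (E4.ofTimeSpace t (D.c t) + s • w))
          (deriv (deriv fun s : ℝ ↦ A.amp (E4.ofTimeSpace t (D.c t) + s • w)) 0) 0 :=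
        (((contDiff_infty_iff_deriv.1 hac).2.differentiable (by simp)) 0).hasDerivAt
      have hflat := line_flat_two_mul hg0 hg'0 hg hg' hg'' ha ha'
      rw [hfun]
    · exact hflat.2.1
    · exact hflat.2.2
  · -- outside the hull the slice vanishes identically
    have hzero : (fun y ↦ A.eikErr (t, y)) = fun _ ↦ 0 := funext (A.eikErr_of_not_mem ht)
    rw [hzero, iteratedFDeriv_fun_zero]
    rfl

/-- **Flat bound for the eikonal error**: `‖a(x) s(dφ,dφ)(x)‖ ≤ D₁ ‖x⃗ − c(x⁰)‖³` whenever
`x⁰` lies in the hull (in particular for `0 ≤ x⁰ ≤ T`). [cite: Sbierski2015, §3 (second lemma, proof)] -/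
theorem exists_eik_bound : ∃ D₁ : ℝ, 0 ≤ D₁ ∧ ∀ t ∈ A.timeHull, ∀ y : E3,
    ‖A.amp (E4.ofTimeSpace t y) * defect G D.P D.M D.c (E4.ofTimeSpace t y)‖ ≤
      D₁ * ‖y - D.c t‖ ^ 3 := by
  obtain ⟨D₁, hD₁, h⟩ := Literature.Analysis.Asymptotics.GaussianBeam.exists_norm_le_norm_sub_pow
    A.ce A.contDiff_ce A.eikErr A.contDiff_eikErr A.hasCompactSupport_eikErr 2
    fun t k hk ↦ A.iteratedFDeriv_eikErr_eq_zero t hk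
  refine ⟨D₁, hD₁, fun t ht y ↦ ?_⟩
  have := h t y
  rwa [A.ce_eq ht] at this

end BeamAmp

/-! ### The transport error `2 s(dφ, da) + a □φ` vanishes on the curve -/

namespace BeamAmp

variable {G : E4 → Fin 4 → Fin 4 → ℝ} {V : Set E4} {J : Set ℝ} {D : BeamData G V J} {T : ℝ}
  (A : BeamAmp D T)

/-- `∂φ` is `C^∞` on the slab. [folklore] -/
theorem _root_.Literature.Geometry.Lorentzian.GaussianBeam.BeamData.contDiffOn_dC_φ
    (D : BeamData G V J) (ν : Fin 4) :
    ContDiffOn ℝ ∞ (fun x ↦ dC D.φ x ν) {x : E4 | x 0 ∈ J} :=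
  (D.contDiffOn_φ.fderiv_of_isOpen (isOpen_slab D.hJ) le_rfl).clm_apply contDiffOn_const

/-- The inner functions `y ↦ ∑_ν G^{μν} ∂_νφ` of `□φ` are `C^∞` on `V ∩ {x⁰ ∈ J}`. [folklore] -/
theorem _root_.Literature.Geometry.Lorentzian.GaussianBeam.BeamData.contDiffOn_inner_φ
    (D : BeamData G V J) (μ : Fin 4) :
    ContDiffOn ℝ ∞ (fun y ↦ ∑ ν, (G y μ ν : ℂ) * dC D.φ y ν) (V ∩ {x : E4 | x 0 ∈ J}) :=
  ContDiffOn.sum fun ν _ ↦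
    (Complex.ofRealCLM.contDiff.comp_contDiffOn ((D.hG μ ν).mono inter_subset_left)).mul
      ((D.contDiffOn_dC_φ ν).mono inter_subset_right)

/-- **`□φ` is `C^∞` on `V ∩ {x⁰ ∈ J}`.** [folklore] -/
theorem _root_.Literature.Geometry.Lorentzian.GaussianBeam.BeamData.contDiffOn_waveOperatorC_φ
    (D : BeamData G V J) :
    ContDiffOn ℝ ∞ (waveOperatorC G D.φ) (V ∩ {x : E4 | x 0 ∈ J}) := by
  unfold waveOperatorC
  refine ContDiffOn.sum fun μ _ ↦ ?_
  exact ((D.contDiffOn_inner_φ μ).fderiv_of_isOpen D.isOpen_inter_slab le_rfl).clm_apply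
    contDiffOn_const

/-- `∂a` is `C^∞`. [folklore] -/
theorem contDiff_dC_amp (ν : Fin 4) : ContDiff ℝ ∞ fun x ↦ dC A.amp x ν :=
  (A.smooth.fderiv_right (m := ∞) le_rfl).clm_apply contDiff_const

/-- `∂a` is supported in `supp a`. [folklore] -/
theorem tsupport_dC_amp_subset (ν : Fin 4) : tsupport (fun x ↦ dC A.amp x ν) ⊆ tsupport A.amp := by
  refine closure_minimal (fun x hx ↦ ?_) (isClosed_tsupport _)
  by_contra h
  exact hx (A.dC_amp_eq_zero h ν)

/-- **The transport error** `2 s(dφ, da) + a □φ` as a function on the chart.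
[cite: Sbierski2015, §3 (3.10)] -/
def trErrE (x : E4) : ℂ := 2 * symbolC G x (dC D.φ x) (dC A.amp x) + A.amp x * waveOperatorC G D.φ x

/-- The transport error is `C^∞` on the chart. [folklore] -/
theorem contDiff_trErrE : ContDiff ℝ ∞ A.trErrE := by
  have h1 : ContDiff ℝ ∞ fun x ↦ symbolC G x (dC D.φ x) (dC A.amp x) := by
    unfold symbolC
    refine ContDiff.sum fun μ _ ↦ ContDiff.sum fun ν _ ↦ ?_
    exact contDiff_mul_of_tsupport' D.isOpen_inter_slab (A.contDiff_dC_amp ν)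
      ((A.tsupport_dC_amp_subset ν).trans A.tsupp)
      ((Complex.ofRealCLM.contDiff.comp_contDiffOn ((D.hG μ ν).mono inter_subset_left)).mul
        ((D.contDiffOn_dC_φ μ).mono inter_subset_right))
  have h2 : ContDiff ℝ ∞ fun x ↦ A.amp x * waveOperatorC G D.φ x :=
    contDiff_mul_of_tsupport D.isOpen_inter_slab A.smooth A.tsupp D.contDiffOn_waveOperatorC_φ
  exact (contDiff_const.mul h1).add h2

/-- The transport error is supported in `supp a`. [folklore] -/
theorem trErrE_eq_zero {x : E4} (hx : x ∉ tsupport A.amp) : A.trErrE x = 0 := by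
  simp [trErrE, symbolC, A.dC_amp_eq_zero hx, image_eq_zero_of_notMem_tsupport hx]

/-- The transport error has compact support. [folklore] -/
theorem hasCompactSupport_trErrE : HasCompactSupport A.trErrE :=
  IsCompact.of_isClosed_subset A.compact (isClosed_tsupport _)
    (closure_minimal (fun x hx ↦ by
      by_contra h
      exact hx (A.trErrE_eq_zero h)) (isClosed_tsupport _))

/-- **The transport error vanishes on the curve** over the core range `(−η, T + η)`.
[cite: Sbierski2015, §3 (3.10); arXiv v2 §2.2 (2.11), p. 14] -/
theorem trErrE_X {t : ℝ} (ht : t ∈ Ioo (-A.η) (T + A.η)) : A.trErrE (D.X t) = 0 := by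
  have htJ : t ∈ J := A.Ioo_subset ht
  have h := transport_curve_eq_zero G D.P D.M D.c D.hJ D.hJc D.h0 D.hP D.hM D.hc D.hV D.hG
    D.hGsymm (κ := D.κ) (q := D.q) D.contDiffOn_q (fun t _ ↦ D.q_eq t)
    (fun t ht ↦ (D.hκpos t ht).ne') D.hPX htJ (D.hXV t htJ) (D.hsymm t htJ) (D.hMX t htJ)
    (D.hvel t htJ) (a := A.amp) (A.core t ht)
  simpa [trErrE, BeamData.X, BeamData.φ] using h

/-- A bump in time equal to one on `[0, T]` and supported in `(−η, T + η)`. [folklore] -/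
def timeBump : ContDiffBump (T / 2) where
  rIn := T / 2 + A.η / 3
  rOut := T / 2 + 2 * A.η / 3
  rIn_pos := by linarith [A.hT0, A.hη]
  rIn_lt_rOut := by linarith [A.hη]

/-- The time bump is one on `[0, T]`. [folklore] -/
theorem timeBump_eq_one {t : ℝ} (ht : t ∈ Icc (0 : ℝ) T) : (A.timeBump : ℝ → ℝ) t = 1 := by
  apply A.timeBump.one_of_mem_closedBall
  rw [Metric.mem_closedBall, Real.dist_eq, abs_le]
  have : A.timeBump.rIn = T / 2 + A.η / 3 := rfl
  rw [this]
  exact ⟨by linarith [ht.1, ht.2, A.hη], by linarith [ht.1, ht.2, A.hη]⟩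

/-- Where the time bump is nonzero, the time lies in the core range. [folklore] -/
theorem mem_Ioo_of_timeBump_ne_zero {t : ℝ} (ht : (A.timeBump : ℝ → ℝ) t ≠ 0) :
    t ∈ Ioo (-A.η) (T + A.η) := by
  have hmem : t ∈ Function.support (A.timeBump : ℝ → ℝ) := ht
  rw [A.timeBump.support_eq, Metric.mem_ball, Real.dist_eq, abs_lt] at hmem
  have : A.timeBump.rOut = T / 2 + 2 * A.η / 3 := rfl
  rw [this] at hmem
  exact ⟨by linarith [hmem.1, A.hη], by linarith [hmem.2, A.hη]⟩

/-- **The transport error, cut off in time to the core range**, read on `ℝ × E3`.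
[cite: Sbierski2015, §3 (second lemma, proof)] -/
def trErr (q : ℝ × E3) : ℂ := ((A.timeBump : ℝ → ℝ) q.1 : ℂ) * A.trErrE (E4.ofTimeSpace q.1 q.2)

/-- The cut transport error is `C^∞`. [folklore] -/
theorem contDiff_trErr : ContDiff ℝ ∞ A.trErr :=
  (Complex.ofRealCLM.contDiff.comp (A.timeBump.contDiff.comp contDiff_fst)).mul
    (A.contDiff_trErrE.comp contDiff_ofTimeSpace_uncurry)

/-- The cut transport error has compact support. [folklore] -/
theorem hasCompactSupport_trErr : HasCompactSupport A.trErr :=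
  (hasCompactSupport_comp_ofTimeSpace A.hasCompactSupport_trErrE).mul_left

/-- **The cut transport error vanishes along the centre** (order `0`). [cite: Sbierski2015, §3 (3.10)] -/
theorem iteratedFDeriv_trErr_eq_zero (t : ℝ) {k : ℕ} (hk : k ≤ 0) :
    iteratedFDeriv ℝ k (fun y ↦ A.trErr (t, y)) (A.ce t) = 0 := by
  obtain rfl : k = 0 := Nat.le_zero.1 hk
  ext m
  rw [iteratedFDeriv_zero_apply, zero_apply]
  by_cases hρ : (A.timeBump : ℝ → ℝ) t = 0
  · simp [trErr, hρ]
  · have ht := A.mem_Ioo_of_timeBump_ne_zero hρ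
    rw [A.ce_eq (A.Ioo_subset_timeHull ht)]
    have h := A.trErrE_X ht
    simp only [BeamData.X] at h
    simp [trErr, h]

/-- **Flat bound for the transport error over `[0, T]`**: `‖2 s(dφ,da) + a □φ‖(x) ≤ D₂ ‖x⃗ − c(x⁰)‖`
for `0 ≤ x⁰ ≤ T`. [cite: Sbierski2015, §3 (second lemma, proof)] -/
theorem exists_tr_bound : ∃ D₂ : ℝ, 0 ≤ D₂ ∧ ∀ t ∈ Icc (0 : ℝ) T, ∀ y : E3,
    ‖A.trErrE (E4.ofTimeSpace t y)‖ ≤ D₂ * ‖y - D.c t‖ := by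
  obtain ⟨D₂, hD₂, h⟩ := Literature.Analysis.Asymptotics.GaussianBeam.exists_norm_le_norm_sub_pow
    A.ce A.contDiff_ce A.trErr A.contDiff_trErr A.hasCompactSupport_trErr 0
    fun t k hk ↦ A.iteratedFDeriv_trErr_eq_zero t hk
  refine ⟨D₂, hD₂, fun t ht y ↦ ?_⟩
  have := h t y
  rw [A.ce_eq (A.Icc_subset_timeHull ht), zero_add, pow_one] at this
  simpa [trErr, A.timeBump_eq_one ht] using this

/-! ### `□a` is bounded; `Im φ` is coercive over the hull -/

/-- The inner functions `y ↦ ∑_ν G^{μν} ∂_νa` of `□a` are `C^∞`. [folklore] -/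
theorem contDiff_inner_amp (μ : Fin 4) : ContDiff ℝ ∞ fun y ↦ ∑ ν, (G y μ ν : ℂ) * dC A.amp y ν :=
  ContDiff.sum fun ν _ ↦ contDiff_mul_of_tsupport' D.isOpen_inter_slab (A.contDiff_dC_amp ν)
    ((A.tsupport_dC_amp_subset ν).trans A.tsupp)
    (Complex.ofRealCLM.contDiff.comp_contDiffOn ((D.hG μ ν).mono inter_subset_left))

/-- **`□a` is `C^∞` on the chart.** [folklore] -/
theorem contDiff_waveOperatorC_amp : ContDiff ℝ ∞ (waveOperatorC G A.amp) := by
  unfold waveOperatorC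
  exact ContDiff.sum fun μ _ ↦
    ((A.contDiff_inner_amp μ).fderiv_right (m := ∞) le_rfl).clm_apply contDiff_const

/-- `□a` vanishes off `supp a`. [folklore] -/
theorem waveOperatorC_amp_eq_zero {x : E4} (hx : x ∉ tsupport A.amp) : waveOperatorC G A.amp x = 0 := by
  unfold waveOperatorC
  refine Finset.sum_eq_zero fun μ _ ↦ ?_
  have hzero : (fun y ↦ ∑ ν, (G y μ ν : ℂ) * dC A.amp y ν) =ᶠ[𝓝 x] fun _ ↦ 0 := by
    filter_upwards [(isClosed_tsupport A.amp).isOpen_compl.mem_nhds hx] with y hy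
    simp [A.dC_amp_eq_zero hy]
  rw [hzero.fderiv_eq]
  simp

/-- `□a` has compact support. [folklore] -/
theorem hasCompactSupport_waveOperatorC_amp : HasCompactSupport (waveOperatorC G A.amp) :=
  IsCompact.of_isClosed_subset A.compact (isClosed_tsupport _)
    (closure_minimal (fun x hx ↦ by
      by_contra h
      exact hx (A.waveOperatorC_amp_eq_zero h)) (isClosed_tsupport _))

/-- **`‖□a‖ ≤ D₃`.** [cite: Sbierski2015, §3 (second lemma, proof)] -/
theorem exists_box_amp_bound : ∃ D₃ : ℝ, 0 ≤ D₃ ∧ ∀ x : E4, ‖waveOperatorC G A.amp x‖ ≤ D₃ := by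
  obtain ⟨D₃, hD₃⟩ := A.contDiff_waveOperatorC_amp.continuous.bounded_above_of_compact_support
    A.hasCompactSupport_waveOperatorC_amp
  exact ⟨max D₃ 0, le_max_right _ _, fun x ↦ (hD₃ x).trans (le_max_left _ _)⟩

/-- **`Im φ(x) ≥ c₀ ‖x⃗ − c(x⁰)‖²` over the hull** (in particular on `supp a` and on the slab
`0 ≤ x⁰ ≤ T`). [cite: Sbierski2015, §3 (display preceding the first lemma)] -/
theorem exists_pos_le_im_φ : ∃ c₀ : ℝ, 0 < c₀ ∧ ∀ x : E4, x 0 ∈ A.timeHull →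
    c₀ * ‖E4.spatial x - D.c (x 0)‖ ^ 2 ≤ (D.φ x).im :=
  D.exists_pos_le_im_φ isCompact_Icc A.timeHull_subset

end BeamAmp

end GaussianBeam

end Literature.Geometry.Lorentzian
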